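import Summits.BirchSwinnertonDyer.Rank1Residual.Additive.ThreeAdicLift
import Literature.NumberTheory.EllipticCurves.ThreeTorsionRadicalProofs
import Mathlib.RingTheory.DedekindDomain.AdicValuation
import Mathlib.AlgebraicGeometry.EllipticCurve.VariableChange
import HarnessLib

/-!
# The `3`-division polynomial `Ψ₃ = 3x⁴ + b₂x³ + 3b₄x² + 3b₆x + b₈` on the Kodaira-III shape of
# `(b₂, b₄, b₆, b₈)` at a place where `3` is a uniformiser: AT MOST ONE ROOT (valued-field algebra;
# the local kernel of `O5.NonSplitAtThreeLaw`, file `O5/NonSplitAtThreeLawHolds.lean`)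
# (cell `b2b-bsdres`; seat `b2b-bsdres-x11b3-p7` GEN 8 as CROSS-CELL POOL HAND for cc-typer-5 / o5-r1's
#  THEOREM-CANDIDATE G3-1′ of `O5/O5CompanionTransport.lean`; theorems only)

HONEST FRAMING (cell `b2b-bsdres`, run/shared/lean/b2b/bsd-rank1-residual/, verbatim in every file): the
goal of the cell is to DELETE the COMBINATION-SHAPED residual classes of the Birch–Swinnerton-Dyer formula
for ALL analytic-rank `≤ 1` elliptic curves over `ℚ` — "full BSD formula for every rank `≤ 1` curve in
class `C`" assembled STRICTLY from published theorems — so that the rank-`≤ 1` remainder becomes exactly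
the CONSTRUCTION-SHAPED classes, which are TYPED (missing-input `Prop`s), NOT attempted. This is not
"finishing BSD". Lane CLASS-CLOSURE / teams o5–o6 (O5 OPEN): research routes; census output is
EVIDENCE, never a Literature fact; nothing is booked; no mark of `RESIDUAL-MAP.md` moves. This file:
THEOREMS ONLY (no definition, no named fact, no `@[conjecture]` node, no `sorry`; net named-fact debt
`0`). It proves NOTHING about any elliptic curve: pure algebra in a field `F` carrying a valuation
`w : F → ℤᵐ⁰` and an element `ϖ = 3` with `w ϖ = exp (−1)`.

## What is proved (all `[folklore]`; the valuation convention is Mathlib's multiplicative one,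
## `w x ≤ 1` = integral, `w ϖ = exp (−1)`)

Write `Ψ₃(x) = 3x⁴ + b₂x³ + 3b₄x² + 3b₆x + b₈` and call `(b₂, b₄, b₆, b₈)` of **type-III shape** when
`b₂, b₄ ∈ ϖ𝒪`, `b₆ ∈ ϖ²𝒪`, `4b₈ = b₂b₆ − b₄²` and `w Δ = exp (−3)`, `Δ = −b₂²b₈ − 8b₄³ − 27b₆² + 9b₂b₄b₆`
— the shape of Tate's Step-4 normal form of a Kodaira-III fibre at residue characteristic `3`
(Silverman *ATAEC* IV.9.4: `π ∣ a₁, a₂, a₃, a₄`, `π² ∤ a₄`, `π² ∣ a₆`, `v(Δ) = 3`).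
* `map_b₈_of_shapeIII`: then `w b₈ = exp (−2)` (if `b₄ ∈ ϖ²𝒪` every term of `Δ` is in `ϖ⁵𝒪`; so `b₄` is
  `ϖ`·unit and `b₄²` dominates `b₂b₆` in `4b₈`).
* `map_root_eq_one_of_shapeIII`: every root of `Ψ₃` in `F` is a UNIT (a non-integral root makes `3r⁴`
  dominate strictly — read on `y = r⁻¹`; a root in `ϖ𝒪` makes `b₈` dominate strictly).
* `root_eq_root_of_shapeIII`: **`Ψ₃` has at most one root in `F`.** For roots `r ≠ s` put `σ = r + s`,
  `π₀ = rs`, `c₁ = b₂ + 3σ`, `c₀ = 3b₄ + c₁σ − 3π₀`; the polynomial identities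
  `s·Ψ₃(r) − r·Ψ₃(s) = (r − s)(c₀π₀ − b₈)` and `Ψ₃(r) − Ψ₃(s) = (r − s)(3b₆ + c₀σ − c₁π₀)` (`ring`) give
  `c₀π₀ = b₈` — so `w c₀ = exp (−2)` — and `c₁π₀ = 3b₆ + c₀σ` — so `c₁ ∈ ϖ²𝒪` —, whence
  `c₀ = (3b₄ + c₁σ) − 3π₀` has `w c₀ = w (3π₀) = exp (−1)`: contradiction. (Equivalently: the Newton
  polygon of `Ψ₃` has slopes `{1/3, 1/3, 1/3, 0}` or `{1/4, 1/4, 1/4, 1/4}`; the argument above avoids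
  Newton polygons, which the tree lacks in this form.)
* `eval_Ψ₃_variableChange` (`Ψ₃'(u⁻²(y − r)) = u⁻⁸·Ψ₃(y)` along a change of variables `(u, r, s, t)`,
  from Mathlib's `variableChange_b₂ … b₈` and the tree's `WeierstrassCurve.eval_Ψ₃_eq`) and
  `Ψ₃_root_unique_of_variableChange` (root-uniqueness transfers down a change of variables) — any
  commutative ring.
The type-III* shape (`b₂ ∈ ϖ²𝒪, b₄ ∈ ϖ³𝒪, b₆ ∈ ϖ⁵𝒪, w Δ = exp (−9)`) reduces to type III by the weight
rescaling `bᵢ ↦ bᵢ/ϖ^{i/2}`, `x ↦ x/ϖ` — done curve-side in `O5/NonSplitAtThreeLawHolds.lean`.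

References: J. H. Silverman, *Advanced Topics in the Arithmetic of Elliptic Curves*, GTM 151 (1994),
IV.9.4 Steps 4, 9 [SilvermanATAEC1994]; J.-P. Serre, Invent. Math. 15 (1972) §1.11 (the statement
`NonSplitAtThreeLaw` it serves) [Serre1972].
-/

noncomputable section

open Polynomial WeierstrassCurve WithZero

open Summit.BirchSwinnertonDyer.Rank1Residual.Additive.ThreeAdicLift (le_exp_sub_one_of_lt_exp)

namespace Summit.BirchSwinnertonDyer.Rank1Residual.O5

namespace NonSplitAtThree

/-! ## §1 Valued-field algebra: `Ψ₃ = 3x⁴ + b₂x³ + 3b₄x² + 3b₆x + b₈` on the type-III shape -/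

section Valued

variable {F : Type*} [Field F] (w : Valuation F ℤᵐ⁰)

/-- Products: `w x ≤ exp a → w y ≤ exp b → w (xy) ≤ exp (a + b)`. [folklore] -/
theorem map_mul_le_exp_add {x y : F} {a b : ℤ} (hx : w x ≤ exp a) (hy : w y ≤ exp b) :
    w (x * y) ≤ exp (a + b) := by
  rw [map_mul, exp_add]
  exact mul_le_mul' hx hy

variable {ϖ : F}

/-- `w 3 = exp (−1)` when `3 = ϖ` is the uniformiser. [folklore] -/
theorem map_three (h3 : (3 : F) = ϖ) (hϖ : w ϖ = exp (-1 : ℤ)) : w 3 = exp (-1 : ℤ) := by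
  rw [h3, hϖ]

/-- **Type-III shape ⟹ `w b₈ = exp (−2)`.** On `b₂ ∈ ϖ𝒪`, `b₄ ∈ ϖ𝒪`, `b₆ ∈ ϖ²𝒪` with
`4b₈ = b₂b₆ − b₄²` and `w Δ = exp (−3)` (`Δ = −b₂²b₈ − 8b₄³ − 27b₆² + 9b₂b₄b₆`): if `b₄ ∈ ϖ²𝒪` every
term of `Δ` lies in `ϖ⁵𝒪` — absurd; so `b₄` is `ϖ`·unit, `b₄²` dominates `b₂b₆`, and `w (4b₈) = exp (−2)`
(`4 = 1 + 3` is a unit). [folklore] -/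
theorem map_b₈_of_shapeIII (h3 : (3 : F) = ϖ) (hϖ : w ϖ = exp (-1 : ℤ)) {b₂ b₄ b₆ b₈ : F}
    (hb₂ : w b₂ ≤ exp (-1 : ℤ)) (hb₄ : w b₄ ≤ exp (-1 : ℤ)) (hb₆ : w b₆ ≤ exp (-2 : ℤ))
    (hrel : 4 * b₈ = b₂ * b₆ - b₄ ^ 2)
    (hΔ : w (-b₂ ^ 2 * b₈ - 8 * b₄ ^ 3 - 27 * b₆ ^ 2 + 9 * b₂ * b₄ * b₆) = exp (-3 : ℤ)) :
    w b₈ = exp (-2 : ℤ) := by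
  have w3 := map_three w h3 hϖ
  have w4 : w 4 = 1 := by
    rw [show (4 : F) = 1 + 3 by norm_num]
    exact Valuation.map_one_add_of_lt w (by rw [w3, ← exp_zero, exp_lt_exp]; norm_num)
  have w8 : w 8 ≤ exp (0 : ℤ) := by
    rw [show (8 : F) = 3 * 3 - 1 by norm_num, exp_zero]
    refine Valuation.map_sub_le w ?_ (by rw [map_one])
    rw [map_mul, w3, ← exp_add, ← exp_zero, exp_le_exp]; norm_num
  have w27 : w 27 ≤ exp (-3 : ℤ) := by
    rw [show (27 : F) = 3 * 3 * 3 by norm_num, map_mul, map_mul, w3, ← exp_add, ← exp_add]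
    exact le_of_eq (by norm_num)
  have w9 : w 9 ≤ exp (-2 : ℤ) := by
    rw [show (9 : F) = 3 * 3 by norm_num, map_mul, w3, ← exp_add]
    exact le_of_eq (by norm_num)
  rcases hb₄.eq_or_lt with h4eq | h4lt
  · -- `b₄ = ϖ · unit`: `b₄²` dominates `b₂ b₆`
    have hsq : w (b₄ ^ 2) = exp (-2 : ℤ) := by
      rw [map_pow, h4eq, ← exp_nsmul]; norm_num
    have hlt : w (b₂ * b₆) < w (b₄ ^ 2) := by
      rw [hsq]
      exact lt_of_le_of_lt (map_mul_le_exp_add w hb₂ hb₆) (by rw [exp_lt_exp]; norm_num)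
    have h := Valuation.map_sub_eq_of_lt_right w hlt
    rw [← hrel, map_mul, w4, one_mul, hsq] at h
    exact h
  · -- `b₄ ∈ ϖ²𝒪`: every term of `Δ` is in `ϖ⁵𝒪`, contradicting `w Δ = exp (−3)`
    exfalso
    have hb₄' : w b₄ ≤ exp (-2 : ℤ) := by
      have := le_exp_sub_one_of_lt_exp h4lt
      rwa [show (-1 : ℤ) - 1 = -2 by norm_num] at this
    have hb₈' : w b₈ ≤ exp (-3 : ℤ) := by
      have h : w (4 * b₈) ≤ exp (-3 : ℤ) := by
        rw [hrel]
        refine Valuation.map_sub_le w (map_mul_le_exp_add w hb₂ hb₆) ?_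
        rw [map_pow]
        calc w b₄ ^ 2 ≤ exp (-2 : ℤ) ^ 2 := pow_le_pow_left' hb₄' 2
          _ ≤ exp (-3 : ℤ) := by rw [← exp_nsmul, exp_le_exp]; norm_num
      rwa [map_mul, w4, one_mul] at h
    have hT1 : w (-b₂ ^ 2 * b₈) ≤ exp (-5 : ℤ) := by
      rw [Valuation.map_mul, Valuation.map_neg, map_pow]
      calc w b₂ ^ 2 * w b₈ ≤ exp (-1 : ℤ) ^ 2 * exp (-3 : ℤ) :=
            mul_le_mul' (pow_le_pow_left' hb₂ 2) hb₈'
        _ = exp (-5 : ℤ) := by rw [← exp_nsmul, ← exp_add]; norm_num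
    have hT2 : w (8 * b₄ ^ 3) ≤ exp (-5 : ℤ) := by
      rw [map_mul, map_pow]
      calc w 8 * w b₄ ^ 3 ≤ exp (0 : ℤ) * exp (-2 : ℤ) ^ 3 :=
            mul_le_mul' w8 (pow_le_pow_left' hb₄' 3)
        _ ≤ exp (-5 : ℤ) := by rw [← exp_nsmul, ← exp_add, exp_le_exp]; norm_num
    have hT3 : w (27 * b₆ ^ 2) ≤ exp (-5 : ℤ) := by
      rw [map_mul, map_pow]
      calc w 27 * w b₆ ^ 2 ≤ exp (-3 : ℤ) * exp (-2 : ℤ) ^ 2 :=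
            mul_le_mul' w27 (pow_le_pow_left' hb₆ 2)
        _ ≤ exp (-5 : ℤ) := by rw [← exp_nsmul, ← exp_add, exp_le_exp]; norm_num
    have hT4 : w (9 * b₂ * b₄ * b₆) ≤ exp (-5 : ℤ) := by
      rw [map_mul, map_mul, map_mul]
      calc w 9 * w b₂ * w b₄ * w b₆ ≤ exp (-2 : ℤ) * exp (-1 : ℤ) * exp (-2 : ℤ) * exp (-2 : ℤ) :=
            mul_le_mul' (mul_le_mul' (mul_le_mul' w9 hb₂) hb₄') hb₆
        _ ≤ exp (-5 : ℤ) := by rw [← exp_add, ← exp_add, ← exp_add, exp_le_exp]; norm_num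
    have hle : w (-b₂ ^ 2 * b₈ - 8 * b₄ ^ 3 - 27 * b₆ ^ 2 + 9 * b₂ * b₄ * b₆) ≤ exp (-5 : ℤ) :=
      Valuation.map_add_le w (Valuation.map_sub_le w (Valuation.map_sub_le w hT1 hT2) hT3) hT4
    rw [hΔ, exp_le_exp] at hle
    norm_num at hle

/-- **Every root of `Ψ₃` is a UNIT on the type-III shape** (`b₂, b₄, b₆ ∈ ϖ𝒪`, `w b₈ = exp (−2)`): for a
non-integral root `3r⁴` dominates strictly (seen on `3 + b₂y + 3b₄y² + 3b₆y³ + b₈y⁴ = 0`, `y = r⁻¹ ∈ ϖ𝒪`),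
for a root in `ϖ𝒪` the constant `b₈` dominates strictly. [folklore] -/
theorem map_root_eq_one_of_shapeIII (h3 : (3 : F) = ϖ) (hϖ : w ϖ = exp (-1 : ℤ)) {b₂ b₄ b₆ b₈ : F}
    (hb₂ : w b₂ ≤ exp (-1 : ℤ)) (hb₄ : w b₄ ≤ exp (-1 : ℤ)) (hb₆ : w b₆ ≤ exp (-1 : ℤ))
    (hb₈ : w b₈ = exp (-2 : ℤ)) {r : F}
    (hr : 3 * r ^ 4 + b₂ * r ^ 3 + 3 * b₄ * r ^ 2 + 3 * b₆ * r + b₈ = 0) : w r = 1 := by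
  have w3 := map_three w h3 hϖ
  have h3le : w 3 ≤ exp (-1 : ℤ) := w3.le
  rcases lt_trichotomy (w r) 1 with hlt | heq | hgt
  · -- `r ∈ ϖ𝒪`: `b₈` dominates
    exfalso
    have hr1 : w r ≤ exp (-1 : ℤ) := by
      have := le_exp_sub_one_of_lt_exp (n := 0) (by rwa [exp_zero])
      rwa [show (0 : ℤ) - 1 = -1 by norm_num] at this
    have hS : w (3 * r ^ 4 + b₂ * r ^ 3 + 3 * b₄ * r ^ 2 + 3 * b₆ * r) ≤ exp (-3 : ℤ) := by
      refine Valuation.map_add_le w (Valuation.map_add_le w (Valuation.map_add_le w ?_ ?_) ?_) ?_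
      · rw [map_mul, map_pow]
        calc w 3 * w r ^ 4 ≤ exp (-1 : ℤ) * exp (-1 : ℤ) ^ 4 := mul_le_mul' h3le (pow_le_pow_left' hr1 4)
          _ ≤ exp (-3 : ℤ) := by rw [← exp_nsmul, ← exp_add, exp_le_exp]; norm_num
      · rw [map_mul, map_pow]
        calc w b₂ * w r ^ 3 ≤ exp (-1 : ℤ) * exp (-1 : ℤ) ^ 3 := mul_le_mul' hb₂ (pow_le_pow_left' hr1 3)
          _ ≤ exp (-3 : ℤ) := by rw [← exp_nsmul, ← exp_add, exp_le_exp]; norm_num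
      · rw [map_mul, map_mul, map_pow]
        calc w 3 * w b₄ * w r ^ 2 ≤ exp (-1 : ℤ) * exp (-1 : ℤ) * exp (-1 : ℤ) ^ 2 :=
              mul_le_mul' (mul_le_mul' h3le hb₄) (pow_le_pow_left' hr1 2)
          _ ≤ exp (-3 : ℤ) := by rw [← exp_nsmul, ← exp_add, ← exp_add, exp_le_exp]; norm_num
      · rw [map_mul, map_mul]
        calc w 3 * w b₆ * w r ≤ exp (-1 : ℤ) * exp (-1 : ℤ) * exp (-1 : ℤ) :=
              mul_le_mul' (mul_le_mul' h3le hb₆) hr1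
          _ ≤ exp (-3 : ℤ) := by rw [← exp_add, ← exp_add, exp_le_exp]; norm_num
    have hlt' : w (3 * r ^ 4 + b₂ * r ^ 3 + 3 * b₄ * r ^ 2 + 3 * b₆ * r) < w b₈ := by
      rw [hb₈]; exact lt_of_le_of_lt hS (by rw [exp_lt_exp]; norm_num)
    have h := Valuation.map_add_eq_of_lt_right w hlt'
    rw [hr, map_zero, hb₈] at h
    exact exp_ne_zero h.symm
  · exact heq
  · -- `r ∉ 𝒪`: `3 r⁴` dominates; read on `y = r⁻¹`
    exfalso
    have hr0 : r ≠ 0 := by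
      rintro rfl
      rw [map_zero] at hgt
      exact not_lt_of_ge zero_le hgt
    set y := r⁻¹ with hy
    have hry : r * y = 1 := mul_inv_cancel₀ hr0
    have hwy : w y < 1 := by
      refine lt_of_not_ge fun hle ↦ ?_
      have h1 : (1 : ℤᵐ⁰) < w r * w y := one_lt_mul_of_lt_of_le' hgt hle
      rw [← map_mul, hry, map_one] at h1
      exact lt_irrefl _ h1
    have hy1 : w y ≤ exp (-1 : ℤ) := by
      have := le_exp_sub_one_of_lt_exp (n := 0) (by rwa [exp_zero])
      rwa [show (0 : ℤ) - 1 = -1 by norm_num] at this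
    have hr' : 3 + (b₂ * y + 3 * b₄ * y ^ 2 + 3 * b₆ * y ^ 3 + b₈ * y ^ 4) = 0 := by
      linear_combination y ^ 4 * hr -
        (3 * (r ^ 3 * y ^ 3 + r ^ 2 * y ^ 2 + r * y + 1) + b₂ * y * (r ^ 2 * y ^ 2 + r * y + 1) +
          3 * b₄ * y ^ 2 * (r * y + 1) + 3 * b₆ * y ^ 3) * hry
    have hB : w (b₂ * y + 3 * b₄ * y ^ 2 + 3 * b₆ * y ^ 3 + b₈ * y ^ 4) ≤ exp (-2 : ℤ) := by
      refine Valuation.map_add_le w (Valuation.map_add_le w (Valuation.map_add_le w ?_ ?_) ?_) ?_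
      · calc w (b₂ * y) ≤ exp (-1 + -1 : ℤ) := map_mul_le_exp_add w hb₂ hy1
          _ = exp (-2 : ℤ) := by norm_num
      · rw [map_mul, map_mul, map_pow]
        calc w 3 * w b₄ * w y ^ 2 ≤ exp (-1 : ℤ) * exp (-1 : ℤ) * exp (-1 : ℤ) ^ 2 :=
              mul_le_mul' (mul_le_mul' h3le hb₄) (pow_le_pow_left' hy1 2)
          _ ≤ exp (-2 : ℤ) := by rw [← exp_nsmul, ← exp_add, ← exp_add, exp_le_exp]; norm_num
      · rw [map_mul, map_mul, map_pow]
        calc w 3 * w b₆ * w y ^ 3 ≤ exp (-1 : ℤ) * exp (-1 : ℤ) * exp (-1 : ℤ) ^ 3 :=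
              mul_le_mul' (mul_le_mul' h3le hb₆) (pow_le_pow_left' hy1 3)
          _ ≤ exp (-2 : ℤ) := by rw [← exp_nsmul, ← exp_add, ← exp_add, exp_le_exp]; norm_num
      · rw [map_mul, map_pow, hb₈]
        calc exp (-2 : ℤ) * w y ^ 4 ≤ exp (-2 : ℤ) * exp (-1 : ℤ) ^ 4 :=
              mul_le_mul' le_rfl (pow_le_pow_left' hy1 4)
          _ ≤ exp (-2 : ℤ) := by rw [← exp_nsmul, ← exp_add, exp_le_exp]; norm_num
    have hlt' : w (b₂ * y + 3 * b₄ * y ^ 2 + 3 * b₆ * y ^ 3 + b₈ * y ^ 4) < w 3 := by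
      rw [w3]; exact lt_of_le_of_lt hB (by rw [exp_lt_exp]; norm_num)
    have h := Valuation.map_add_eq_of_lt_left w hlt'
    rw [hr', map_zero, w3] at h
    exact exp_ne_zero h.symm

/-- **`Ψ₃` has at most ONE root on the type-III shape.** Two roots `r ≠ s` (units by
`map_root_eq_one_of_shapeIII`), `σ = r + s`, `π₀ = rs`, `c₁ = b₂ + 3σ`, `c₀ = 3b₄ + c₁σ − 3π₀`: the
identities `s·Ψ₃(r) − r·Ψ₃(s) = (r − s)(c₀π₀ − b₈)` and `Ψ₃(r) − Ψ₃(s) = (r − s)(3b₆ + c₀σ − c₁π₀)` give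
`c₀π₀ = b₈` (so `w c₀ = exp (−2)`) and `c₁π₀ = 3b₆ + c₀σ` (so `c₁ ∈ ϖ²𝒪`), whence
`c₀ = (3b₄ + c₁σ) − 3π₀` has `w c₀ = w (3π₀) = exp (−1)` — contradiction. [folklore] -/
theorem root_eq_root_of_shapeIII (h3 : (3 : F) = ϖ) (hϖ : w ϖ = exp (-1 : ℤ)) {b₂ b₄ b₆ b₈ : F}
    (hb₂ : w b₂ ≤ exp (-1 : ℤ)) (hb₄ : w b₄ ≤ exp (-1 : ℤ)) (hb₆ : w b₆ ≤ exp (-1 : ℤ))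
    (hb₈ : w b₈ = exp (-2 : ℤ)) {r s : F}
    (hr : 3 * r ^ 4 + b₂ * r ^ 3 + 3 * b₄ * r ^ 2 + 3 * b₆ * r + b₈ = 0)
    (hs : 3 * s ^ 4 + b₂ * s ^ 3 + 3 * b₄ * s ^ 2 + 3 * b₆ * s + b₈ = 0) : r = s := by
  have w3 := map_three w h3 hϖ
  have h3le : w 3 ≤ exp (-1 : ℤ) := w3.le
  have wr := map_root_eq_one_of_shapeIII w h3 hϖ hb₂ hb₄ hb₆ hb₈ hr
  have ws := map_root_eq_one_of_shapeIII w h3 hϖ hb₂ hb₄ hb₆ hb₈ hs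
  by_contra hne
  have hrs : r - s ≠ 0 := sub_ne_zero.mpr hne
  -- the two symmetric-function identities
  have hB : (3 * b₄ + (b₂ + 3 * (r + s)) * (r + s) - 3 * (r * s)) * (r * s) = b₈ := by
    have h : (r - s) * ((3 * b₄ + (b₂ + 3 * (r + s)) * (r + s) - 3 * (r * s)) * (r * s) - b₈) =
        s * (3 * r ^ 4 + b₂ * r ^ 3 + 3 * b₄ * r ^ 2 + 3 * b₆ * r + b₈) -
          r * (3 * s ^ 4 + b₂ * s ^ 3 + 3 * b₄ * s ^ 2 + 3 * b₆ * s + b₈) := by ring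
    rw [hr, hs, mul_zero, mul_zero, sub_zero, mul_eq_zero] at h
    exact sub_eq_zero.mp (h.resolve_left hrs)
  have hA : (b₂ + 3 * (r + s)) * (r * s) =
      3 * b₆ + (3 * b₄ + (b₂ + 3 * (r + s)) * (r + s) - 3 * (r * s)) * (r + s) := by
    have h : (r - s) * (3 * b₆ + (3 * b₄ + (b₂ + 3 * (r + s)) * (r + s) - 3 * (r * s)) * (r + s) -
        (b₂ + 3 * (r + s)) * (r * s)) =
        (3 * r ^ 4 + b₂ * r ^ 3 + 3 * b₄ * r ^ 2 + 3 * b₆ * r + b₈) -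
          (3 * s ^ 4 + b₂ * s ^ 3 + 3 * b₄ * s ^ 2 + 3 * b₆ * s + b₈) := by ring
    rw [hr, hs, sub_zero, mul_eq_zero] at h
    exact (sub_eq_zero.mp (h.resolve_left hrs)).symm
  set σ := r + s with hσ
  set π₀ := r * s with hπ₀
  set c₁ := b₂ + 3 * σ with hc₁
  set c₀ := 3 * b₄ + c₁ * σ - 3 * π₀ with hc₀
  -- valuations
  have wπ₀ : w π₀ = 1 := by rw [hπ₀, map_mul, wr, ws, one_mul]
  have wσ : w σ ≤ 1 := Valuation.map_add_le w wr.le ws.le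
  have wc₀ : w c₀ = exp (-2 : ℤ) := by
    have := congrArg w hB
    rwa [map_mul, wπ₀, mul_one, hb₈] at this
  have wc₁ : w c₁ ≤ exp (-2 : ℤ) := by
    have h : w (c₁ * π₀) ≤ exp (-2 : ℤ) := by
      rw [hA]
      refine Valuation.map_add_le w ?_ ?_
      · calc w (3 * b₆) ≤ exp (-1 + -1 : ℤ) := map_mul_le_exp_add w h3le hb₆
          _ = exp (-2 : ℤ) := by norm_num
      · rw [map_mul, wc₀]
        calc exp (-2 : ℤ) * w σ ≤ exp (-2 : ℤ) * 1 := mul_le_mul' le_rfl wσ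
          _ = exp (-2 : ℤ) := mul_one _
    rwa [map_mul, wπ₀, mul_one] at h
  have hlt : w (3 * b₄ + c₁ * σ) < w (3 * π₀) := by
    rw [map_mul, w3, wπ₀, mul_one]
    refine lt_of_le_of_lt (Valuation.map_add_le w ?_ ?_ : _ ≤ exp (-2 : ℤ)) (by rw [exp_lt_exp]; norm_num)
    · calc w (3 * b₄) ≤ exp (-1 + -1 : ℤ) := map_mul_le_exp_add w h3le hb₄
        _ = exp (-2 : ℤ) := by norm_num
    · rw [map_mul]
      calc w c₁ * w σ ≤ exp (-2 : ℤ) * 1 := mul_le_mul' wc₁ wσ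
        _ = exp (-2 : ℤ) := mul_one _
  have h := Valuation.map_sub_eq_of_lt_right w hlt
  rw [← hc₀, wc₀, map_mul, w3, wπ₀, mul_one, exp_inj] at h
  norm_num at h

end Valued

/-! ## §2 The division polynomial `Ψ₃` evaluated, rescaled, and moved along a change of variables -/

section Poly

variable {R : Type*} [CommRing R]

/-- **`Ψ₃` along a change of variables** `(u, r, s, t)`: `Ψ₃'(u⁻²(y − r)) = u⁻⁸ · Ψ₃(y)` (Taylor shift by
`r` of `Ψ₃`, read on Mathlib's `variableChange_b₂ … b₈`). [folklore] -/
theorem eval_Ψ₃_variableChange (X : WeierstrassCurve R) (C : VariableChange R) (y : R) :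
    (C • X).Ψ₃.eval ((C.u⁻¹ : Rˣ) ^ 2 * (y - C.r)) = (C.u⁻¹ : Rˣ) ^ 8 * X.Ψ₃.eval y := by
  rw [eval_Ψ₃_eq, eval_Ψ₃_eq, variableChange_b₂, variableChange_b₄, variableChange_b₆, variableChange_b₈]
  ring

/-- Root-injectivity transfers DOWN a change of variables: if `(C • X).Ψ₃` has at most one root in `R`,
so has `X.Ψ₃` (`y ↦ u⁻²(y − r)` is injective). [folklore] -/
theorem Ψ₃_root_unique_of_variableChange (X : WeierstrassCurve R) (C : VariableChange R)
    (h : ∀ x y : R, (C • X).Ψ₃.eval x = 0 → (C • X).Ψ₃.eval y = 0 → x = y) (x y : R)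
    (hx : X.Ψ₃.eval x = 0) (hy : X.Ψ₃.eval y = 0) : x = y := by
  have hx' : (C • X).Ψ₃.eval ((C.u⁻¹ : Rˣ) ^ 2 * (x - C.r)) = 0 := by
    rw [eval_Ψ₃_variableChange, hx, mul_zero]
  have hy' : (C • X).Ψ₃.eval ((C.u⁻¹ : Rˣ) ^ 2 * (y - C.r)) = 0 := by
    rw [eval_Ψ₃_variableChange, hy, mul_zero]
  have hxy := h _ _ hx' hy'
  rw [← Units.val_pow_eq_pow_val] at hxy
  have := (Units.mul_right_inj _).mp hxy
  exact sub_left_injective this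

end Poly

end NonSplitAtThree

end Summit.BirchSwinnertonDyer.Rank1Residual.O5

end
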